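import Summits.AtomisticToContinuum.HydrodynamicLimit.Theses.ImplosionDichotomy
import Summits.AtomisticToContinuum.HydrodynamicLimit.Theses.LindebergRandomFuture
import Summits.AtomisticToContinuum.HydrodynamicLimit.Theorems.LambertianContactSwapSwapGapRelEntSwapOfUpper
import Summits.AtomisticToContinuum.HydrodynamicLimit.Theorems.LambertianContactSwapSwapGapLambdaAdiabaticity
import Summits.AtomisticToContinuum.HydrodynamicLimit.Theorems.LambertianContactSwapSwapGapStubStaticBookkeeping
import Summits.AtomisticToContinuum.HydrodynamicLimit.Theorems.LambertianContactSwapSwapGapEntropyTransfer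
import Summits.AtomisticToContinuum.HydrodynamicLimit.Theorems.LambertianContactSwapSwapGapFieldConcentrationOfLD
import HarnessLib

/-!
# `SwapGap` (stmt-AtomisticToContinuum-11850), line `Sketch`: the crux from its three open stubs (state after cycle 3)

Helper file (`--supports`) recording, as unconditional implications between fully written-out statements, what the line
`Sketch` (entropy relative to the Lambertian law) has reduced the crux
`Summit.AtomisticToContinuum.HydrodynamicLimit.Theses.LambertianContactSwap.SwapGap` to after three lead cycles
(skeleton v4, `Cruxes/SwapGap/Lines/Sketch.lean`).  Notation: `P_N` local Gibbs data, `p_t = (Φ_t)_* P_N`,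
`q_t = (Λ_t)_* (P_N ⊗ γ^ℕ)`, `G_N = localGibbsLaw σ 1 0 1 N (Φ N)`, `h_t = llr q_t G_N`.

* `swapGap_of_LD_of_DSC_of_likelihoodGapUpper` (registered sub-goal): `SwapGap` follows from
  (LD) exponential-rate Euler for the Lambertian gas (`stub_lambertianEulerLD`, Λ alone),
  (DSC) `ImplosionDichotomy.DiluteSelfConsistency` (stmt-AtomisticToContinuum-3091) and
  (UP) the one-sided likelihood gap `limsup_N [∫ h_t dq_t − ∫ h_t dp_t]/(N+1) ≤ 0` (`stub_likelihoodGapUpper`);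
  everything else of the line is PROVED: S2 ⇐ LD (`fieldConcentration_of_lambertianEulerLD`, p106600), Euler for Λ ⇐ LD
  (`lambertianEulerNamed_of_LD`), Λ-adiabaticity S1a ⇐ Euler for Λ + DSC + static bookkeeping (`lambdaAdiabaticity_of`,
  p117295, with `stub_staticBookkeeping` LANDED p119962), S1 ⇐ S1a + UP (`relEntSwap_of_upper`), SwapGap ⇐ S1 + S2
  (`swapGap_of_relEntSwap_of_fieldConcentration`, p106427), Λ-Liouville invariance (p116909).
* `swapGap_of_LD_of_relEntSwap`: equivalently `SwapGap ⇐ LD ∧ RelEntSwap` (c0's S1, `KL(p_t ‖ q_t)/(N+1) → 0`), and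
  `likelihoodGapUpper_of_relEntSwap` / `relEntSwap_of_LD_of_DSC_of_likelihoodGapUpper`: given LD and DSC, UP ⟺ RelEntSwap —
  the irreducible comparison content of the line is exactly c0's entropy statement, every Λ-side and static
  obligation having been discharged or isolated into LD / DSC.
prover-line-stmt-AtomisticToContinuum-11850-c2-0 (lead c2, cycle 3).
-/

noncomputable section

open MeasureTheory Filter Set Topology InformationTheory
open scoped ENNReal

namespace Summit.AtomisticToContinuum.HydrodynamicLimit.Theorems.LambertianContactSwapSwapGapOfStubs

open Literature.Analysis.FluidPDE Literature.MathematicalPhysics.KineticTheory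
open Summit.AtomisticToContinuum.HydrodynamicLimit.Theses.LambertianContactSwap
open Summit.AtomisticToContinuum.HydrodynamicLimit.Theorems
open Summit.AtomisticToContinuum.HydrodynamicLimit.Theorems.LambertianContactSwapSwapGapLambdaAdiabaticity
open Summit.AtomisticToContinuum.HydrodynamicLimit.Theorems.LambertianContactSwapSwapGapRelEntSwapOfUpper

/-! ## Euler for `Λ` from its exponential-rate form -/

/-- **Exponential-rate Euler for `Λ` gives Euler for `Λ`** (the sibling crux `LambertianEuler`, stmt-AtomisticToContinuum-11854,
in its named-API form, which is the route decl by `Iff.rfl`): `C e^{-(N+1)/C} → 0`. [folklore] -/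
theorem lambertianEulerNamed_of_LD
    (hLD : ∀ (a₀ θ₀ : T3 → ℝ) (u₀ : T3 → V3), Continuous a₀ → Continuous θ₀ → Continuous u₀ →
      (∀ x, 0 < a₀ x) → (∀ x, 0 < θ₀ x) →
      ∃ σ₀ : ℝ, 0 < σ₀ ∧ ∀ σ : ℝ, 0 < σ → σ < σ₀ →
        ∀ (T : ℝ) (ρ θ : ℝ → T3 → ℝ) (u : ℝ → T3 → V3), IsHardSphereEulerSolution σ T ρ u θ →
          ∀ Φ : (N : ℕ) → HardSphereFlow (Torus.geometry (Fin 3)) (hsDiameter σ N) (N + 1),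
            TendstoHydroFieldsAt (fun N => localGibbsLaw σ a₀ u₀ θ₀ N (Φ N)) Φ ρ u θ 0 →
              ∀ t ∈ Set.Ico 0 T, ∀ χ : T3 → ℝ, Continuous χ → ∀ δ : ℝ, 0 < δ →
                ∃ C : ℝ, 0 < C ∧ ∀ N : ℕ,
                  ((localGibbsLaw σ a₀ u₀ θ₀ N (Φ N)).prod (lambertNoise (Fin 3)))
                      {p | δ < |empiricalDensityField
                          (lambertFlow (Torus.geometry (Fin 3)) (hsDiameter σ N) p.2 p.1 t) χ -
                        ∫ x, χ x * ρ t x|} ≤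
                    ENNReal.ofReal (C * Real.exp (-(C⁻¹ * ((N : ℝ) + 1)))) ∧
                  ((localGibbsLaw σ a₀ u₀ θ₀ N (Φ N)).prod (lambertNoise (Fin 3)))
                      {p | δ < ‖empiricalMomentumField
                          (lambertFlow (Torus.geometry (Fin 3)) (hsDiameter σ N) p.2 p.1 t) χ -
                        ∫ x, (χ x * ρ t x) • u t x‖} ≤
                    ENNReal.ofReal (C * Real.exp (-(C⁻¹ * ((N : ℝ) + 1)))) ∧
                  ((localGibbsLaw σ a₀ u₀ θ₀ N (Φ N)).prod (lambertNoise (Fin 3)))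
                      {p | δ < |empiricalEnergyField
                          (lambertFlow (Torus.geometry (Fin 3)) (hsDiameter σ N) p.2 p.1 t) χ -
                        ∫ x, χ x * totalEnergyDensity (ρ t x) (u t x) (θ t x)|} ≤
                    ENNReal.ofReal (C * Real.exp (-(C⁻¹ * ((N : ℝ) + 1))))) :
    ∀ (a₀ θ₀ : T3 → ℝ) (u₀ : T3 → V3), Continuous a₀ → Continuous θ₀ → Continuous u₀ →
        (∀ x, 0 < a₀ x) → (∀ x, 0 < θ₀ x) →
        ∃ σ₀ : ℝ, 0 < σ₀ ∧ ∀ σ : ℝ, 0 < σ → σ < σ₀ →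
          ∀ (T : ℝ) (ρ θ : ℝ → T3 → ℝ) (u : ℝ → T3 → V3), IsHardSphereEulerSolution σ T ρ u θ →
            ∀ Φ : (N : ℕ) → HardSphereFlow (Torus.geometry (Fin 3)) (hsDiameter σ N) (N + 1),
              TendstoHydroFieldsAt (fun N => localGibbsLaw σ a₀ u₀ θ₀ N (Φ N)) Φ ρ u θ 0 →
                ∀ t ∈ Set.Ico 0 T, ∀ χ : T3 → ℝ, Continuous χ → ∀ δ > (0 : ℝ),
                  Tendsto (fun N : ℕ => ((localGibbsLaw σ a₀ u₀ θ₀ N (Φ N)).prod (lambertNoise (Fin 3)))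
                    {p | δ < |empiricalDensityField
                      (lambertFlow (Torus.geometry (Fin 3)) (hsDiameter σ N) p.2 p.1 t) χ -
                        ∫ x, χ x * ρ t x|}) atTop (nhds 0) ∧
                  Tendsto (fun N : ℕ => ((localGibbsLaw σ a₀ u₀ θ₀ N (Φ N)).prod (lambertNoise (Fin 3)))
                    {p | δ < ‖empiricalMomentumField
                      (lambertFlow (Torus.geometry (Fin 3)) (hsDiameter σ N) p.2 p.1 t) χ -
                        ∫ x, (χ x * ρ t x) • u t x‖}) atTop (nhds 0) ∧
                  Tendsto (fun N : ℕ => ((localGibbsLaw σ a₀ u₀ θ₀ N (Φ N)).prod (lambertNoise (Fin 3)))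
                    {p | δ < |empiricalEnergyField
                      (lambertFlow (Torus.geometry (Fin 3)) (hsDiameter σ N) p.2 p.1 t) χ -
                        ∫ x, χ x * totalEnergyDensity (ρ t x) (u t x) (θ t x)|}) atTop (nhds 0) := by
  intro a₀ θ₀ u₀ ha hθ hu ha0 hθ0
  obtain ⟨σ₀, hσ₀, h⟩ := hLD a₀ θ₀ u₀ ha hθ hu ha0 hθ0
  refine ⟨σ₀, hσ₀, ?_⟩
  intro σ hσ hσlt T ρ θ u hE Φ h0 t ht χ hχ δ hδ
  obtain ⟨C, hC, hN⟩ := h σ hσ hσlt T ρ θ u hE Φ h0 t ht χ hχ δ hδ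
  have hexp : Tendsto (fun N : ℕ => ENNReal.ofReal (C * Real.exp (-(C⁻¹ * ((N : ℝ) + 1)))))
      atTop (𝓝 0) := by
    have h := ENNReal.tendsto_ofReal (tendsto_const_mul_exp_neg_succ C hC)
    rwa [ENNReal.ofReal_zero] at h
  exact ⟨tendsto_of_tendsto_of_tendsto_of_le_of_le tendsto_const_nhds hexp (fun _ => zero_le)
      fun N => (hN N).1,
    tendsto_of_tendsto_of_tendsto_of_le_of_le tendsto_const_nhds hexp (fun _ => zero_le)
      fun N => (hN N).2.1,
    tendsto_of_tendsto_of_tendsto_of_le_of_le tendsto_const_nhds hexp (fun _ => zero_le)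
      fun N => (hN N).2.2⟩

/-! ## The crux from the three open stubs -/

/-- **RelEntSwap from LD, DSC and UP**: `relEntSwap_of_upper` fed with the Λ-adiabiaticity theorem
`lambdaAdiabaticity_of` (itself fed with Euler for Λ from LD, DSC, and the landed static bookkeeping
`SwapGapStaticBookkeeping.stub_staticBookkeeping`). [folklore] -/
theorem relEntSwap_of_LD_of_DSC_of_likelihoodGapUpper
    (hLD : ∀ (a₀ θ₀ : T3 → ℝ) (u₀ : T3 → V3), Continuous a₀ → Continuous θ₀ → Continuous u₀ →
      (∀ x, 0 < a₀ x) → (∀ x, 0 < θ₀ x) →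
      ∃ σ₀ : ℝ, 0 < σ₀ ∧ ∀ σ : ℝ, 0 < σ → σ < σ₀ →
      ∀ (T : ℝ) (ρ θ : ℝ → T3 → ℝ) (u : ℝ → T3 → V3), IsHardSphereEulerSolution σ T ρ u θ →
      ∀ Φ : (N : ℕ) → HardSphereFlow (Torus.geometry (Fin 3)) (hsDiameter σ N) (N + 1),
      TendstoHydroFieldsAt (fun N => localGibbsLaw σ a₀ u₀ θ₀ N (Φ N)) Φ ρ u θ 0 →
      ∀ t ∈ Set.Ico 0 T, ∀ χ : T3 → ℝ, Continuous χ → ∀ δ : ℝ, 0 < δ →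
      ∃ C : ℝ, 0 < C ∧ ∀ N : ℕ,
      ((localGibbsLaw σ a₀ u₀ θ₀ N (Φ N)).prod (lambertNoise (Fin 3)))
      {p | δ < |empiricalDensityField
      (lambertFlow (Torus.geometry (Fin 3)) (hsDiameter σ N) p.2 p.1 t) χ -
      ∫ x, χ x * ρ t x|} ≤
      ENNReal.ofReal (C * Real.exp (-(C⁻¹ * ((N : ℝ) + 1)))) ∧
      ((localGibbsLaw σ a₀ u₀ θ₀ N (Φ N)).prod (lambertNoise (Fin 3)))
      {p | δ < ‖empiricalMomentumField
      (lambertFlow (Torus.geometry (Fin 3)) (hsDiameter σ N) p.2 p.1 t) χ -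
      ∫ x, (χ x * ρ t x) • u t x‖} ≤
      ENNReal.ofReal (C * Real.exp (-(C⁻¹ * ((N : ℝ) + 1)))) ∧
      ((localGibbsLaw σ a₀ u₀ θ₀ N (Φ N)).prod (lambertNoise (Fin 3)))
      {p | δ < |empiricalEnergyField
      (lambertFlow (Torus.geometry (Fin 3)) (hsDiameter σ N) p.2 p.1 t) χ -
      ∫ x, χ x * totalEnergyDensity (ρ t x) (u t x) (θ t x)|} ≤
      ENNReal.ofReal (C * Real.exp (-(C⁻¹ * ((N : ℝ) + 1)))))
    (hDSC : Summit.AtomisticToContinuum.HydrodynamicLimit.Theses.ImplosionDichotomy.DiluteSelfConsistency)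
    (hup : ∀ (a₀ θ₀ : T3 → ℝ) (u₀ : T3 → V3), Continuous a₀ → Continuous θ₀ → Continuous u₀ →
      (∀ x, 0 < a₀ x) → (∀ x, 0 < θ₀ x) →
      ∃ σ₀ : ℝ, 0 < σ₀ ∧ ∀ σ : ℝ, 0 < σ → σ < σ₀ →
      ∀ (T : ℝ) (ρ θ : ℝ → T3 → ℝ) (u : ℝ → T3 → V3), IsHardSphereEulerSolution σ T ρ u θ →
      ∀ Φ : (N : ℕ) → HardSphereFlow (Torus.geometry (Fin 3)) (hsDiameter σ N) (N + 1),
      TendstoHydroFieldsAt (fun N => localGibbsLaw σ a₀ u₀ θ₀ N (Φ N)) Φ ρ u θ 0 →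
      ∀ t ∈ Set.Ico 0 T, ∀ η : ℝ, 0 < η → ∀ᶠ N : ℕ in atTop,
      ((∫ z, llr (((localGibbsLaw σ a₀ u₀ θ₀ N (Φ N)).prod (lambertNoise (Fin 3))).map
      (fun p => lambertFlow (Torus.geometry (Fin 3)) (hsDiameter σ N) p.2 p.1 t))
      (localGibbsLaw σ (fun _ => 1) (fun _ => 0) (fun _ => 1) N (Φ N)) z
      ∂(((localGibbsLaw σ a₀ u₀ θ₀ N (Φ N)).prod (lambertNoise (Fin 3))).map
      (fun p => lambertFlow (Torus.geometry (Fin 3)) (hsDiameter σ N) p.2 p.1 t))) -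
      ∫ z, llr (((localGibbsLaw σ a₀ u₀ θ₀ N (Φ N)).prod (lambertNoise (Fin 3))).map
      (fun p => lambertFlow (Torus.geometry (Fin 3)) (hsDiameter σ N) p.2 p.1 t))
      (localGibbsLaw σ (fun _ => 1) (fun _ => 0) (fun _ => 1) N (Φ N)) z
      ∂((localGibbsLaw σ a₀ u₀ θ₀ N (Φ N)).map ((Φ N).flow t))) /
      ((N : ℝ) + 1) ≤ η) :
    ∀ (a₀ θ₀ : T3 → ℝ) (u₀ : T3 → V3), Continuous a₀ → Continuous θ₀ → Continuous u₀ →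
    (∀ x, 0 < a₀ x) → (∀ x, 0 < θ₀ x) →
    ∃ σ₀ : ℝ, 0 < σ₀ ∧ ∀ σ : ℝ, 0 < σ → σ < σ₀ →
    ∀ (T : ℝ) (ρ θ : ℝ → T3 → ℝ) (u : ℝ → T3 → V3), IsHardSphereEulerSolution σ T ρ u θ →
    ∀ Φ : (N : ℕ) → HardSphereFlow (Torus.geometry (Fin 3)) (hsDiameter σ N) (N + 1),
    TendstoHydroFieldsAt (fun N => localGibbsLaw σ a₀ u₀ θ₀ N (Φ N)) Φ ρ u θ 0 →
    ∀ t ∈ Set.Ico 0 T,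
    Tendsto (fun N : ℕ =>
    klDiv ((localGibbsLaw σ a₀ u₀ θ₀ N (Φ N)).map ((Φ N).flow t))
    (((localGibbsLaw σ a₀ u₀ θ₀ N (Φ N)).prod (lambertNoise (Fin 3))).map
    (fun p => lambertFlow (Torus.geometry (Fin 3)) (hsDiameter σ N) p.2 p.1 t)) /
    ((N : ℝ≥0∞) + 1)) atTop (𝓝 0) :=
  relEntSwap_of_upper
    (lambdaAdiabaticity_of (lambertianEulerNamed_of_LD hLD) hDSC SwapGapStaticBookkeeping.stub_staticBookkeeping) hup

/-- **`SwapGap` from LD and RelEntSwap** (c0's composition with S2 discharged by LD). [folklore] -/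
theorem swapGap_of_LD_of_relEntSwap
    (hLD : ∀ (a₀ θ₀ : T3 → ℝ) (u₀ : T3 → V3), Continuous a₀ → Continuous θ₀ → Continuous u₀ →
      (∀ x, 0 < a₀ x) → (∀ x, 0 < θ₀ x) →
      ∃ σ₀ : ℝ, 0 < σ₀ ∧ ∀ σ : ℝ, 0 < σ → σ < σ₀ →
      ∀ (T : ℝ) (ρ θ : ℝ → T3 → ℝ) (u : ℝ → T3 → V3), IsHardSphereEulerSolution σ T ρ u θ →
      ∀ Φ : (N : ℕ) → HardSphereFlow (Torus.geometry (Fin 3)) (hsDiameter σ N) (N + 1),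
      TendstoHydroFieldsAt (fun N => localGibbsLaw σ a₀ u₀ θ₀ N (Φ N)) Φ ρ u θ 0 →
      ∀ t ∈ Set.Ico 0 T, ∀ χ : T3 → ℝ, Continuous χ → ∀ δ : ℝ, 0 < δ →
      ∃ C : ℝ, 0 < C ∧ ∀ N : ℕ,
      ((localGibbsLaw σ a₀ u₀ θ₀ N (Φ N)).prod (lambertNoise (Fin 3)))
      {p | δ < |empiricalDensityField
      (lambertFlow (Torus.geometry (Fin 3)) (hsDiameter σ N) p.2 p.1 t) χ -
      ∫ x, χ x * ρ t x|} ≤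
      ENNReal.ofReal (C * Real.exp (-(C⁻¹ * ((N : ℝ) + 1)))) ∧
      ((localGibbsLaw σ a₀ u₀ θ₀ N (Φ N)).prod (lambertNoise (Fin 3)))
      {p | δ < ‖empiricalMomentumField
      (lambertFlow (Torus.geometry (Fin 3)) (hsDiameter σ N) p.2 p.1 t) χ -
      ∫ x, (χ x * ρ t x) • u t x‖} ≤
      ENNReal.ofReal (C * Real.exp (-(C⁻¹ * ((N : ℝ) + 1)))) ∧
      ((localGibbsLaw σ a₀ u₀ θ₀ N (Φ N)).prod (lambertNoise (Fin 3)))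
      {p | δ < |empiricalEnergyField
      (lambertFlow (Torus.geometry (Fin 3)) (hsDiameter σ N) p.2 p.1 t) χ -
      ∫ x, χ x * totalEnergyDensity (ρ t x) (u t x) (θ t x)|} ≤
      ENNReal.ofReal (C * Real.exp (-(C⁻¹ * ((N : ℝ) + 1)))))
    (hS1 : ∀ (a₀ θ₀ : T3 → ℝ) (u₀ : T3 → V3), Continuous a₀ → Continuous θ₀ → Continuous u₀ →
      (∀ x, 0 < a₀ x) → (∀ x, 0 < θ₀ x) →
      ∃ σ₀ : ℝ, 0 < σ₀ ∧ ∀ σ : ℝ, 0 < σ → σ < σ₀ →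
      ∀ (T : ℝ) (ρ θ : ℝ → T3 → ℝ) (u : ℝ → T3 → V3), IsHardSphereEulerSolution σ T ρ u θ →
      ∀ Φ : (N : ℕ) → HardSphereFlow (Torus.geometry (Fin 3)) (hsDiameter σ N) (N + 1),
      TendstoHydroFieldsAt (fun N => localGibbsLaw σ a₀ u₀ θ₀ N (Φ N)) Φ ρ u θ 0 →
      ∀ t ∈ Set.Ico 0 T,
      Tendsto (fun N : ℕ =>
      klDiv ((localGibbsLaw σ a₀ u₀ θ₀ N (Φ N)).map ((Φ N).flow t))
      (((localGibbsLaw σ a₀ u₀ θ₀ N (Φ N)).prod (lambertNoise (Fin 3))).map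
      (fun p => lambertFlow (Torus.geometry (Fin 3)) (hsDiameter σ N) p.2 p.1 t)) /
      ((N : ℝ≥0∞) + 1)) atTop (𝓝 0)) : SwapGap :=
  swapGap_of_relEntSwap_of_fieldConcentration hS1 (fieldConcentration_of_lambertianEulerLD hLD)

/-- **`SwapGap` from the three open stubs of line `Sketch` (skeleton v4)**: exponential-rate Euler for the Lambertian gas
(LD), dilute self-consistency of the hs-Euler solution (DSC, stmt-AtomisticToContinuum-3091) and the one-sided likelihood gap
(UP) imply the crux.  Registered sub-goal `swapGap_of_LD_of_DSC_of_likelihoodGapUpper`. [folklore] -/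
theorem swapGap_of_LD_of_DSC_of_likelihoodGapUpper
    (hLD : ∀ (a₀ θ₀ : T3 → ℝ) (u₀ : T3 → V3), Continuous a₀ → Continuous θ₀ → Continuous u₀ →
      (∀ x, 0 < a₀ x) → (∀ x, 0 < θ₀ x) →
      ∃ σ₀ : ℝ, 0 < σ₀ ∧ ∀ σ : ℝ, 0 < σ → σ < σ₀ →
      ∀ (T : ℝ) (ρ θ : ℝ → T3 → ℝ) (u : ℝ → T3 → V3), IsHardSphereEulerSolution σ T ρ u θ →
      ∀ Φ : (N : ℕ) → HardSphereFlow (Torus.geometry (Fin 3)) (hsDiameter σ N) (N + 1),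
      TendstoHydroFieldsAt (fun N => localGibbsLaw σ a₀ u₀ θ₀ N (Φ N)) Φ ρ u θ 0 →
      ∀ t ∈ Set.Ico 0 T, ∀ χ : T3 → ℝ, Continuous χ → ∀ δ : ℝ, 0 < δ →
      ∃ C : ℝ, 0 < C ∧ ∀ N : ℕ,
      ((localGibbsLaw σ a₀ u₀ θ₀ N (Φ N)).prod (lambertNoise (Fin 3)))
      {p | δ < |empiricalDensityField
      (lambertFlow (Torus.geometry (Fin 3)) (hsDiameter σ N) p.2 p.1 t) χ -
      ∫ x, χ x * ρ t x|} ≤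
      ENNReal.ofReal (C * Real.exp (-(C⁻¹ * ((N : ℝ) + 1)))) ∧
      ((localGibbsLaw σ a₀ u₀ θ₀ N (Φ N)).prod (lambertNoise (Fin 3)))
      {p | δ < ‖empiricalMomentumField
      (lambertFlow (Torus.geometry (Fin 3)) (hsDiameter σ N) p.2 p.1 t) χ -
      ∫ x, (χ x * ρ t x) • u t x‖} ≤
      ENNReal.ofReal (C * Real.exp (-(C⁻¹ * ((N : ℝ) + 1)))) ∧
      ((localGibbsLaw σ a₀ u₀ θ₀ N (Φ N)).prod (lambertNoise (Fin 3)))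
      {p | δ < |empiricalEnergyField
      (lambertFlow (Torus.geometry (Fin 3)) (hsDiameter σ N) p.2 p.1 t) χ -
      ∫ x, χ x * totalEnergyDensity (ρ t x) (u t x) (θ t x)|} ≤
      ENNReal.ofReal (C * Real.exp (-(C⁻¹ * ((N : ℝ) + 1)))))
    (hDSC : Summit.AtomisticToContinuum.HydrodynamicLimit.Theses.ImplosionDichotomy.DiluteSelfConsistency)
    (hup : ∀ (a₀ θ₀ : T3 → ℝ) (u₀ : T3 → V3), Continuous a₀ → Continuous θ₀ → Continuous u₀ →
      (∀ x, 0 < a₀ x) → (∀ x, 0 < θ₀ x) →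
      ∃ σ₀ : ℝ, 0 < σ₀ ∧ ∀ σ : ℝ, 0 < σ → σ < σ₀ →
      ∀ (T : ℝ) (ρ θ : ℝ → T3 → ℝ) (u : ℝ → T3 → V3), IsHardSphereEulerSolution σ T ρ u θ →
      ∀ Φ : (N : ℕ) → HardSphereFlow (Torus.geometry (Fin 3)) (hsDiameter σ N) (N + 1),
      TendstoHydroFieldsAt (fun N => localGibbsLaw σ a₀ u₀ θ₀ N (Φ N)) Φ ρ u θ 0 →
      ∀ t ∈ Set.Ico 0 T, ∀ η : ℝ, 0 < η → ∀ᶠ N : ℕ in atTop,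
      ((∫ z, llr (((localGibbsLaw σ a₀ u₀ θ₀ N (Φ N)).prod (lambertNoise (Fin 3))).map
      (fun p => lambertFlow (Torus.geometry (Fin 3)) (hsDiameter σ N) p.2 p.1 t))
      (localGibbsLaw σ (fun _ => 1) (fun _ => 0) (fun _ => 1) N (Φ N)) z
      ∂(((localGibbsLaw σ a₀ u₀ θ₀ N (Φ N)).prod (lambertNoise (Fin 3))).map
      (fun p => lambertFlow (Torus.geometry (Fin 3)) (hsDiameter σ N) p.2 p.1 t))) -
      ∫ z, llr (((localGibbsLaw σ a₀ u₀ θ₀ N (Φ N)).prod (lambertNoise (Fin 3))).map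
      (fun p => lambertFlow (Torus.geometry (Fin 3)) (hsDiameter σ N) p.2 p.1 t))
      (localGibbsLaw σ (fun _ => 1) (fun _ => 0) (fun _ => 1) N (Φ N)) z
      ∂((localGibbsLaw σ a₀ u₀ θ₀ N (Φ N)).map ((Φ N).flow t))) /
      ((N : ℝ) + 1) ≤ η) : SwapGap :=
  swapGap_of_LD_of_relEntSwap hLD (relEntSwap_of_LD_of_DSC_of_likelihoodGapUpper hLD hDSC hup)

/-- The same term closes the sister route's byte-identical copy of the crux. [folklore] -/
theorem lindebergSwapGap_of_LD_of_DSC_of_likelihoodGapUpper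
    (hLD : ∀ (a₀ θ₀ : T3 → ℝ) (u₀ : T3 → V3), Continuous a₀ → Continuous θ₀ → Continuous u₀ →
      (∀ x, 0 < a₀ x) → (∀ x, 0 < θ₀ x) →
      ∃ σ₀ : ℝ, 0 < σ₀ ∧ ∀ σ : ℝ, 0 < σ → σ < σ₀ →
      ∀ (T : ℝ) (ρ θ : ℝ → T3 → ℝ) (u : ℝ → T3 → V3), IsHardSphereEulerSolution σ T ρ u θ →
      ∀ Φ : (N : ℕ) → HardSphereFlow (Torus.geometry (Fin 3)) (hsDiameter σ N) (N + 1),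
      TendstoHydroFieldsAt (fun N => localGibbsLaw σ a₀ u₀ θ₀ N (Φ N)) Φ ρ u θ 0 →
      ∀ t ∈ Set.Ico 0 T, ∀ χ : T3 → ℝ, Continuous χ → ∀ δ : ℝ, 0 < δ →
      ∃ C : ℝ, 0 < C ∧ ∀ N : ℕ,
      ((localGibbsLaw σ a₀ u₀ θ₀ N (Φ N)).prod (lambertNoise (Fin 3)))
      {p | δ < |empiricalDensityField
      (lambertFlow (Torus.geometry (Fin 3)) (hsDiameter σ N) p.2 p.1 t) χ -
      ∫ x, χ x * ρ t x|} ≤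
      ENNReal.ofReal (C * Real.exp (-(C⁻¹ * ((N : ℝ) + 1)))) ∧
      ((localGibbsLaw σ a₀ u₀ θ₀ N (Φ N)).prod (lambertNoise (Fin 3)))
      {p | δ < ‖empiricalMomentumField
      (lambertFlow (Torus.geometry (Fin 3)) (hsDiameter σ N) p.2 p.1 t) χ -
      ∫ x, (χ x * ρ t x) • u t x‖} ≤
      ENNReal.ofReal (C * Real.exp (-(C⁻¹ * ((N : ℝ) + 1)))) ∧
      ((localGibbsLaw σ a₀ u₀ θ₀ N (Φ N)).prod (lambertNoise (Fin 3)))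
      {p | δ < |empiricalEnergyField
      (lambertFlow (Torus.geometry (Fin 3)) (hsDiameter σ N) p.2 p.1 t) χ -
      ∫ x, χ x * totalEnergyDensity (ρ t x) (u t x) (θ t x)|} ≤
      ENNReal.ofReal (C * Real.exp (-(C⁻¹ * ((N : ℝ) + 1)))))
    (hDSC : Summit.AtomisticToContinuum.HydrodynamicLimit.Theses.ImplosionDichotomy.DiluteSelfConsistency)
    (hup : ∀ (a₀ θ₀ : T3 → ℝ) (u₀ : T3 → V3), Continuous a₀ → Continuous θ₀ → Continuous u₀ →
      (∀ x, 0 < a₀ x) → (∀ x, 0 < θ₀ x) →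
      ∃ σ₀ : ℝ, 0 < σ₀ ∧ ∀ σ : ℝ, 0 < σ → σ < σ₀ →
      ∀ (T : ℝ) (ρ θ : ℝ → T3 → ℝ) (u : ℝ → T3 → V3), IsHardSphereEulerSolution σ T ρ u θ →
      ∀ Φ : (N : ℕ) → HardSphereFlow (Torus.geometry (Fin 3)) (hsDiameter σ N) (N + 1),
      TendstoHydroFieldsAt (fun N => localGibbsLaw σ a₀ u₀ θ₀ N (Φ N)) Φ ρ u θ 0 →
      ∀ t ∈ Set.Ico 0 T, ∀ η : ℝ, 0 < η → ∀ᶠ N : ℕ in atTop,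
      ((∫ z, llr (((localGibbsLaw σ a₀ u₀ θ₀ N (Φ N)).prod (lambertNoise (Fin 3))).map
      (fun p => lambertFlow (Torus.geometry (Fin 3)) (hsDiameter σ N) p.2 p.1 t))
      (localGibbsLaw σ (fun _ => 1) (fun _ => 0) (fun _ => 1) N (Φ N)) z
      ∂(((localGibbsLaw σ a₀ u₀ θ₀ N (Φ N)).prod (lambertNoise (Fin 3))).map
      (fun p => lambertFlow (Torus.geometry (Fin 3)) (hsDiameter σ N) p.2 p.1 t))) -
      ∫ z, llr (((localGibbsLaw σ a₀ u₀ θ₀ N (Φ N)).prod (lambertNoise (Fin 3))).map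
      (fun p => lambertFlow (Torus.geometry (Fin 3)) (hsDiameter σ N) p.2 p.1 t))
      (localGibbsLaw σ (fun _ => 1) (fun _ => 0) (fun _ => 1) N (Φ N)) z
      ∂((localGibbsLaw σ a₀ u₀ θ₀ N (Φ N)).map ((Φ N).flow t))) /
      ((N : ℝ) + 1) ≤ η) :
    Summit.AtomisticToContinuum.HydrodynamicLimit.Theses.LindebergRandomFuture.SwapGap :=
  swapGap_of_LD_of_DSC_of_likelihoodGapUpper hLD hDSC hup

end Summit.AtomisticToContinuum.HydrodynamicLimit.Theorems.LambertianContactSwapSwapGapOfStubs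

end
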